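import Literature.NumberTheory.QuadraticFields.ImaginaryQuadraticPrescribedSplitting
import Mathlib.Data.Nat.ChineseRemainder
import Mathlib.FieldTheory.Finite.Basic
import HarnessLib

/-!
# Imaginary quadratic fields with prescribed split AND inert primes (Dirichlet + CRT)

Topic `NumberTheory/QuadraticFields`, namespace `Literature.NumberTheory.QuadraticFields.Quadratic`
(continuing `ImaginaryQuadraticPrescribedSplitting.lean`, which treats the all-split case needed by
automorphy lifting). Everything here is PROVED (theorems only, no named facts).

The Iwasawa-theoretic arguments for elliptic curves over an auxiliary imaginary quadratic field
`L` in the DEFINITE setting (Bertolini–Darmon, Vatsal, Chida–Hsieh, Skinner–Urban, and the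
supersingular main conjecture of Burungale–Skinner–Tian–Wan, arXiv:2409.01350v2, Part II §2.3)
choose `L` with a prescribed finite set of primes SPLIT (the good prime `p`, the primes of `N⁺`,
and `2`) and a prescribed disjoint finite set INERT (the primes of `N⁻`), all unramified. The
existence of such a field is Dirichlet's theorem on primes in arithmetic progressions plus the
decomposition law; we prove it here in the currency of this directory ("`l` splits in `K`" is
`((Ideal.span {(l : ℤ)}).primesOver (𝓞 K)).ncard = 2`, "`l` is inert" is `… = 1` together with
`¬ l ∣ d_K`), with NO condition on the class number (contrast the class-number-indivisibility
statements of Wiles, JLMS 92 (2015) Thm. 0.0.1, or Bhargava–Varma 2016 Cor. 4, typed in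
`ThreeIndivisibleClassNumberLocalConditions.lean`).

* `ncard_primesOver_eq_one_of_legendreSym_eq_neg_one` / `…_of_jacobiSym_eq_neg_one` — the inert
  case of the decomposition law at an odd prime (`(d_K / p) = −1` ⟹ one prime above `p`; Marcus,
  *Number Fields*, Ch. 3 Thm. 25), companion of `ncard_primesOver_eq_two_iff_jacobiSym`
  (`KroneckerSplitting.lean`). (The Summits-side lemma
  `Summit.BirchSwinnertonDyer.Rank1Residual.Supersingular.BSTWScope.ncard_primesOver_eq_one_of_jacobiSym_eq_neg_one`
  is the same statement; this is its Literature home.)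
* `ncard_primesOver_two_eq_one_of_discr_mod_eight` — `d_K ≡ 5 (mod 8)` ⟹ `2` is inert
  (`X² − X − 1` irreducible mod `2`; Marcus, Ch. 3 Thm. 25).
* `exists_prime_prescribed_residues` — Dirichlet + CRT: for disjoint finite sets `S`, `T` of primes
  and any bound there is a prime `r > n`, `r ∉ S ∪ T`, `r ≡ 7 (mod 8)` (or `≡ 3 (mod 8)` when
  `2 ∈ T`), `r ≡ −1 (mod ℓ)` for the odd `ℓ ∈ S`, and `−r` a quadratic NON-residue mod each odd
  `q ∈ T`.
* `exists_imaginaryQuadratic_split_inert` — the field `L = ℚ(√−r)`: `[L : ℚ] = 2`, `d_L = −r < 0`,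
  every prime of `S` split and prime to `d_L`, every prime of `T` inert and prime to `d_L`.
  This is EXACTLY the displayed hypothesis CL(p) of
  `Summits/…/Theorems/SignedLowerHalvesKobayashiLowerHalfSemistableScopeReduction.lean` with its
  class-number clause `¬ p ∣ h_L` removed — i.e. the class-number-free part of the auxiliary-field
  existence is a THEOREM at every `p`.

## References

* D. A. Marcus, *Number Fields*, 2nd ed. (2018), Ch. 3 Thm. 25 (decomposition law).
* K. Ireland, M. Rosen, *A Classical Introduction to Modern Number Theory*, GTM 84, Prop. 13.1.3–4.
* P. G. L. Dirichlet (1837) / Mathlib `Nat.forall_exists_prime_gt_and_zmodEq`.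
-/

noncomputable section

open Module NumberField Polynomial Ideal UniqueFactorizationMonoid

namespace Literature.NumberTheory.QuadraticFields.Quadratic

/-! ### The inert cases of the decomposition law -/

section Inert

variable {K : Type*} [Field K] [NumberField K]

/-- **Inert case of the decomposition law at an odd prime** (Marcus, *Number Fields*, Ch. 3,
Thm. 25): for a quadratic field `K` and a prime `p` with Legendre symbol `(d_K / p) = −1` there is
exactly ONE prime of `𝓞 K` above `p`. With an integral basis `(1, ω)`, `ω² = m + tω`,
`minpoly ω = X² − tX − m` has discriminant `d_K = t² + 4m`, a non-square mod `p`, so it stays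
irreducible mod `p` (Dedekind–Kummer, `ncard_primesOver_eq_card_toFinset`).
[cite: Marcus2018, Ch. 3 Thm. 25 (decomposition law, inert case at odd p)] -/
theorem ncard_primesOver_eq_one_of_legendreSym_eq_neg_one (h2 : finrank ℚ K = 2) {p : ℕ}
    [hp : Fact p.Prime] (hl : legendreSym p (NumberField.discr K) = -1) :
    ((span {(p : ℤ)}).primesOver (𝓞 K)).ncard = 1 := by
  obtain ⟨b, hb⟩ := exists_basis_zero_eq_one h2
  rw [ncard_primesOver_eq_card_toFinset b hb]
  rw [discr_eq_sq_add_four_mul b hb] at hl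
  generalize b.repr (b 1 * b 1) 1 = t at hl ⊢
  generalize b.repr (b 1 * b 1) 0 = m at hl ⊢
  have hcast : (((t ^ 2 + 4 * m : ℤ)) : ZMod p) = (t : ZMod p) ^ 2 + 4 * (m : ZMod p) := by
    push_cast
    ring
  have hns : ¬ IsSquare ((t : ZMod p) ^ 2 + 4 * (m : ZMod p)) :=
    hcast ▸ (legendreSym.eq_neg_one_iff p).mp hl
  exact card_toFinset_normalizedFactors_X_sq_sub_of_not_isSquare hns

/-- The same with Mathlib's Jacobi symbol `J(d_K | p)` (no `Fact` instance needed; at `p = 2`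
the hypothesis is never satisfied). [cite: Marcus2018, Ch. 3 Thm. 25 (decomposition law, inert case at odd p)] -/
theorem ncard_primesOver_eq_one_of_jacobiSym_eq_neg_one (h2 : finrank ℚ K = 2) {p : ℕ}
    (hp : p.Prime) (hj : jacobiSym (NumberField.discr K) p = -1) :
    ((span {(p : ℤ)}).primesOver (𝓞 K)).ncard = 1 := by
  haveI : Fact p.Prime := ⟨hp⟩
  exact ncard_primesOver_eq_one_of_legendreSym_eq_neg_one h2
    (by rw [jacobiSym.legendreSym.to_jacobiSym]; exact hj)

/-- **Inert case of the decomposition law at `2`** (Marcus, *Number Fields*, Ch. 3, Thm. 25): for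
a quadratic field `K` with `d_K ≡ 5 (mod 8)` there is exactly ONE prime of `𝓞 K` above `2`.
With `(1, ω)`, `ω² = m + tω`, `d_K = t² + 4m ≡ 5 (mod 8)` forces `t`, `m` odd, and then
`minpoly ω ≡ X² + X + 1 (mod 2)` is irreducible.
[cite: Marcus2018, Ch. 3 Thm. 25 (decomposition law at 2: d ≡ 5 (mod 8) inert)] -/
theorem ncard_primesOver_two_eq_one_of_discr_mod_eight (h2 : finrank ℚ K = 2)
    (h5 : NumberField.discr K % 8 = 5) :
    ((span {(2 : ℤ)}).primesOver (𝓞 K)).ncard = 1 := by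
  obtain ⟨b, hb⟩ := exists_basis_zero_eq_one h2
  haveI := Fact.mk Nat.prime_two
  have hc := ncard_primesOver_eq_card_toFinset b hb (p := 2)
  simp only [Nat.cast_ofNat] at hc
  rw [hc]
  rw [discr_eq_sq_add_four_mul b hb] at h5
  generalize b.repr (b 1 * b 1) 1 = t at h5 ⊢
  generalize b.repr (b 1 * b 1) 0 = m at h5 ⊢
  have h20 : (2 : ZMod 2) = 0 := rfl
  have hodd : ∀ k : ℤ, ((2 * k + 1 : ℤ) : ZMod 2) = 1 := fun k => by
    rw [Int.cast_add, Int.cast_mul, Int.cast_ofNat, h20, zero_mul, zero_add, Int.cast_one]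
  obtain ⟨k, rfl | rfl⟩ := Int.even_or_odd' t <;> obtain ⟨j, rfl | rfl⟩ := Int.even_or_odd' m
  · exfalso
    have : (2 * k) ^ 2 + 4 * (2 * j) = 4 * (k ^ 2 + 2 * j) := by ring
    rw [this] at h5
    generalize k ^ 2 + 2 * j = y at h5
    omega
  · exfalso
    have : (2 * k) ^ 2 + 4 * (2 * j + 1) = 4 * (k ^ 2 + 2 * j + 1) := by ring
    rw [this] at h5
    generalize k ^ 2 + 2 * j + 1 = y at h5
    omega
  · exfalso
    obtain ⟨i, hi⟩ := Int.even_mul_succ_self k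
    have : (2 * k + 1) ^ 2 + 4 * (2 * j) = 8 * (i + j) + 1 := by linear_combination 4 * hi
    rw [this] at h5
    omega
  · -- `t` odd, `m` odd: `X² + X + 1`, irreducible
    rw [hodd, hodd]
    exact card_toFinset_normalizedFactors_X_sq_sub_one_one_zmod_two

end Inert

/-! ### Dirichlet + CRT: a prime in the right classes modulo `8` and modulo the odd primes of `S ∪ T` -/

section Dirichlet

/-- An odd prime has a quadratic non-residue, as an integer (private helper). [folklore] -/
private theorem exists_int_not_isSquare_zmod {l : ℕ} (hl : l.Prime) (hl2 : l ≠ 2) :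
    ∃ m : ℤ, ¬ IsSquare ((m : ℤ) : ZMod l) := by
  haveI : Fact l.Prime := ⟨hl⟩
  have hc : ringChar (ZMod l) ≠ 2 := by rw [ZMod.ringChar_zmod_n]; exact hl2
  obtain ⟨x, hx⟩ := FiniteField.exists_nonsquare hc
  refine ⟨(x.val : ℤ), ?_⟩
  rwa [Int.cast_natCast, ZMod.natCast_zmod_val]

/-- **Dirichlet + CRT.** Let `S`, `T` be disjoint finite sets of primes and `n` a bound. There is
a prime `r > n`, `r ∉ S ∪ T`, with `r ≡ 3 (mod 4)` — precisely `r ≡ 3 (mod 8)` if `2 ∈ T` and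
`r ≡ 7 (mod 8)` otherwise — such that `r ≡ −1 (mod ℓ)` for every odd `ℓ ∈ S` (so `−r` is a
non-zero square mod `ℓ`) and `−r` is a quadratic NON-residue modulo every odd `q ∈ T`.
Proof: pick a non-residue `m_q` mod each odd `q ∈ T`; the system `x ≡ 7 or 3 (mod 8)`,
`x ≡ −1 (mod ℓ)`, `x ≡ −m_q (mod q)` has a solution prime to `8 ∏ ℓ ∏ q` (CRT), and Dirichlet's
theorem gives a prime in that class beyond any bound.
[cite: IrelandRosen1990, Ch. 16 §1 Thm. 1 (Dirichlet's theorem on primes in arithmetic progressions)] -/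
theorem exists_prime_prescribed_residues (S T : Finset ℕ) (hS : ∀ p ∈ S, p.Prime)
    (hT : ∀ q ∈ T, q.Prime) (hST : Disjoint S T) (n : ℕ) :
    ∃ r : ℕ, r.Prime ∧ n < r ∧ r ∉ S ∧ r ∉ T ∧ r % 4 = 3 ∧
      (2 ∉ T → r % 8 = 7) ∧ (2 ∈ T → r % 8 = 3) ∧
      (∀ ℓ ∈ S, ℓ ≠ 2 → (r : ZMod ℓ) = -1) ∧
      (∀ q ∈ T, q ≠ 2 → (r : ZMod q) ≠ 0 ∧ ¬ IsSquare (-(r : ZMod q))) := by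
  classical
  -- non-residues at the odd primes (a function on all of `ℕ`, meaningful at odd primes)
  have H : ∀ l : ℕ, ∃ m : ℤ, (l.Prime ∧ l ≠ 2) → ¬ IsSquare ((m : ℤ) : ZMod l) := by
    intro l
    by_cases h : l.Prime ∧ l ≠ 2
    · obtain ⟨m, hm⟩ := exists_int_not_isSquare_zmod h.1 h.2
      exact ⟨m, fun _ => hm⟩
    · exact ⟨0, fun h' => (h h').elim⟩
  choose ns hns using H
  -- the CRT data: index set `U ∪ {2}`, `U` = the odd primes of `S ∪ T`; modulus `8` at the index `2`
  set U : Finset ℕ := (S ∪ T).erase 2 with hU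
  set t : Finset ℕ := insert 2 U with ht
  set s : ℕ → ℕ := fun i => if i = 2 then 8 else i with hs_def
  set a : ℕ → ℕ := fun i => if i = 2 then (if 2 ∈ T then 3 else 7) else
    (if i ∈ S then i - 1 else ((-(ns i) : ℤ) : ZMod i).val) with ha_def
  have hUprime : ∀ i ∈ U, i.Prime ∧ i ≠ 2 := by
    intro i hi
    rw [hU, Finset.mem_erase, Finset.mem_union] at hi
    rcases hi.2 with h | h
    · exact ⟨hS i h, hi.1⟩
    · exact ⟨hT i h, hi.1⟩
  have hs2 : s 2 = 8 := by rw [hs_def]; simp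
  have hsU : ∀ i ∈ U, s i = i := by
    intro i hi
    rw [hs_def]
    simp [(hUprime i hi).2]
  have hs0 : ∀ i ∈ t, s i ≠ 0 := by
    intro i hi
    rw [ht, Finset.mem_insert] at hi
    rcases hi with rfl | hi
    · rw [hs2]; norm_num
    · rw [hsU i hi]; exact (hUprime i hi).1.ne_zero
  have hpp : Set.Pairwise (↑t : Set ℕ) (Function.onFun Nat.Coprime s) := by
    intro i hi j hj hij
    rw [Finset.mem_coe, ht, Finset.mem_insert] at hi hj
    have h8 : ∀ k ∈ U, Nat.Coprime 8 k := by
      intro k hk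
      have h2k : Nat.Coprime 2 k :=
        (Nat.coprime_primes Nat.prime_two (hUprime k hk).1).mpr (hUprime k hk).2.symm
      have : Nat.Coprime (2 ^ 3) k := Nat.Coprime.pow_left 3 h2k
      simpa using this
    rcases hi with rfl | hi <;> rcases hj with rfl | hj
    · exact (hij rfl).elim
    · show Nat.Coprime (s 2) (s j)
      rw [hs2, hsU j hj]; exact h8 j hj
    · show Nat.Coprime (s i) (s 2)
      rw [hs2, hsU i hi]; exact (h8 i hi).symm
    · show Nat.Coprime (s i) (s j)
      rw [hsU i hi, hsU j hj]
      exact (Nat.coprime_primes (hUprime i hi).1 (hUprime j hj).1).mpr hij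
  obtain ⟨k, hk⟩ := Nat.chineseRemainderOfFinset a s t hs0 hpp
  -- `k` is prime to the modulus `M = ∏ s`
  set M : ℕ := ∏ i ∈ t, s i with hM
  have hM0 : M ≠ 0 := Finset.prod_ne_zero_iff.mpr hs0
  have h2t : (2 : ℕ) ∈ t := by rw [ht]; exact Finset.mem_insert_self _ _
  have hUt : ∀ i ∈ U, i ∈ t := fun i hi => by rw [ht]; exact Finset.mem_insert_of_mem hi
  have hk8 : k % 8 = (if 2 ∈ T then 3 else 7) := by
    have := hk 2 h2t
    rw [hs2] at this
    rw [ha_def] at this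
    simp only [if_true] at this
    rw [Nat.ModEq] at this
    split_ifs at this ⊢ with h <;> omega
  -- residues of `k` at the odd primes
  have hkS : ∀ i ∈ U, i ∈ S → (k : ZMod i) = -1 := by
    intro i hi hiS
    have hmod := hk i (hUt i hi)
    rw [hsU i hi] at hmod
    have hai : a i = i - 1 := by rw [ha_def]; simp [(hUprime i hi).2, hiS]
    rw [hai] at hmod
    have := (ZMod.natCast_eq_natCast_iff _ _ _).mpr hmod
    rw [this, Nat.cast_sub (hUprime i hi).1.one_le, Nat.cast_one, ZMod.natCast_self, zero_sub]
  have hkT : ∀ i ∈ U, i ∈ T → (k : ZMod i) = -((ns i : ℤ) : ZMod i) := by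
    intro i hi hiT
    have hiS : i ∉ S := fun h => Finset.disjoint_left.mp hST h hiT
    have hmod := hk i (hUt i hi)
    rw [hsU i hi] at hmod
    have hai : a i = ((-(ns i) : ℤ) : ZMod i).val := by
      rw [ha_def]; simp [(hUprime i hi).2, hiS]
    rw [hai] at hmod
    haveI : NeZero i := ⟨(hUprime i hi).1.ne_zero⟩
    have := (ZMod.natCast_eq_natCast_iff _ _ _).mpr hmod
    rw [this, ZMod.natCast_zmod_val, Int.cast_neg]
  have hkcop : Nat.Coprime k M := by
    rw [hM]
    refine Nat.Coprime.prod_right fun i hi => ?_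
    rw [ht, Finset.mem_insert] at hi
    rcases hi with rfl | hi
    · rw [hs2]
      show Nat.gcd k 8 = 1
      rw [Nat.gcd_comm, Nat.gcd_rec, hk8]
      split_ifs <;> rfl
    · rw [hsU i hi]
      haveI : Fact i.Prime := ⟨(hUprime i hi).1⟩
      refine Nat.Coprime.symm ((Nat.Prime.coprime_iff_not_dvd (hUprime i hi).1).mpr fun hdvd => ?_)
      have hk0 : (k : ZMod i) = 0 := (ZMod.natCast_eq_zero_iff k i).mpr hdvd
      have hi2 : i ∈ S ∨ i ∈ T := by
        have := (Finset.mem_erase.mp (hU ▸ hi)).2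
        exact Finset.mem_union.mp this
      rcases hi2 with hiS | hiT
      · rw [hkS i hi hiS] at hk0
        exact one_ne_zero (neg_eq_zero.mp hk0)
      · rw [hkT i hi hiT, neg_eq_zero] at hk0
        exact hns i (hUprime i hi) (by rw [hk0]; exact IsSquare.zero)
  -- Dirichlet
  obtain ⟨r, hrn, hr, hrmod⟩ := Nat.forall_exists_prime_gt_and_zmodEq
    (max n ((S ∪ T).sup id)) (q := M) (a := (k : ℤ)) hM0 (Nat.isCoprime_iff_coprime.mpr hkcop)
  have hrST : r ∉ S ∪ T := fun h => by
    have : r ≤ (S ∪ T).sup id := Finset.le_sup (f := id) h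
    omega
  rw [Finset.mem_union, not_or] at hrST
  -- transport the congruences to `r`
  have hr_s : ∀ i ∈ t, (r : ZMod (s i)) = (k : ZMod (s i)) := by
    intro i hi
    have hdvd : s i ∣ M := by rw [hM]; exact Finset.dvd_prod_of_mem s hi
    have := intCast_zmod_eq_of_modEq_of_dvd hrmod hdvd
    rwa [Int.cast_natCast, Int.cast_natCast] at this
  have hr8 : r % 8 = (if 2 ∈ T then 3 else 7) := by
    have := hr_s 2 h2t
    rw [hs2] at this
    have h' := (ZMod.natCast_eq_natCast_iff _ _ _).mp this
    rw [Nat.ModEq] at h'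
    rw [h', hk8]
  refine ⟨r, hr, lt_of_le_of_lt (le_max_left _ _) hrn, hrST.1, hrST.2, ?_, ?_, ?_, ?_, ?_⟩
  · rw [← Nat.mod_mod_of_dvd r (by norm_num : 4 ∣ 8), hr8]
    split_ifs <;> rfl
  · intro h2T; rw [hr8, if_neg h2T]
  · intro h2T; rw [hr8, if_pos h2T]
  · intro ℓ hℓS hℓ2
    have hℓU : ℓ ∈ U := by
      rw [hU, Finset.mem_erase, Finset.mem_union]; exact ⟨hℓ2, Or.inl hℓS⟩
    have := hr_s ℓ (hUt ℓ hℓU)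
    rw [hsU ℓ hℓU] at this
    rw [this, hkS ℓ hℓU hℓS]
  · intro q hqT hq2
    have hqU : q ∈ U := by
      rw [hU, Finset.mem_erase, Finset.mem_union]; exact ⟨hq2, Or.inr hqT⟩
    have := hr_s q (hUt q hqU)
    rw [hsU q hqU] at this
    rw [this, hkT q hqU hqT, neg_neg]
    refine ⟨fun h0 => ?_, hns q (hUprime q hqU)⟩
    rw [neg_eq_zero] at h0
    exact hns q (hUprime q hqU) (by rw [h0]; exact IsSquare.zero)

end Dirichlet

/-! ### The field: prescribed split set `S` and inert set `T`, no class-number condition -/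

section SplitInert

/-- **An imaginary quadratic field with prescribed split primes `S` and inert primes `T`.** For
disjoint finite sets `S`, `T` of primes and any bound `n` there are a prime `r > n`, `r ∉ S ∪ T`,
`r ≡ 3 (mod 4)`, and a number field `L` with `[L : ℚ] = 2` and `d_L = −r < 0` (so `L = ℚ(√−r)`
is imaginary quadratic and every prime `≠ r` is unramified) in which **every prime of `S`
splits** and **every prime of `T` is inert**, all prime to `d_L`: `r ≡ −1 (mod ℓ)` makes
`(−r/ℓ) = 1` for odd `ℓ ∈ S`, `−r ≡ 1 (mod 8)` splits `2` (if `2 ∉ T`), `−r ≡ 5 (mod 8)` makes `2`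
inert (if `2 ∈ T`), and `−r` a non-residue mod `q` makes an odd `q ∈ T` inert
(`exists_prime_prescribed_residues` + the decomposition law). This is the CLASS-NUMBER-FREE part of
the auxiliary-field hypothesis of the definite-setting Iwasawa arguments (e.g. Burungale–Skinner–
Tian–Wan arXiv:2409.01350v2 II §2.3: `p` split, `N⁺` split, `N⁻` inert, `(d_L, 2N) = 1`); it is a
theorem at every `p`, in contrast with the class-number-indivisibility refinements (Wiles 2015,
Bhargava–Varma 2016). [cite: IrelandRosen1990, Ch. 16 §1 Thm. 1 (Dirichlet's theorem on primes in arithmetic progressions)]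
[cite: Marcus2018, Ch. 3 Thm. 25 (decomposition law in quadratic fields)] -/
theorem exists_imaginaryQuadratic_split_inert (S T : Finset ℕ) (hS : ∀ p ∈ S, p.Prime)
    (hT : ∀ q ∈ T, q.Prime) (hST : Disjoint S T) (n : ℕ) :
    ∃ (r : ℕ) (L : Type) (_ : Field L) (_ : NumberField L),
      r.Prime ∧ n < r ∧ r ∉ S ∧ r ∉ T ∧ r % 4 = 3 ∧
      finrank ℚ L = 2 ∧ NumberField.discr L = -r ∧
      (∀ p ∈ S, ¬ (p : ℤ) ∣ NumberField.discr L ∧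
        ((span {(p : ℤ)}).primesOver (𝓞 L)).ncard = 2) ∧
      (∀ q ∈ T, ¬ (q : ℤ) ∣ NumberField.discr L ∧
        ((span {(q : ℤ)}).primesOver (𝓞 L)).ncard = 1) ∧
      (∀ l : ℕ, l.Prime → l ≠ r → Algebra.IsUnramifiedIn (𝓞 L) (span {(l : ℤ)})) := by
  obtain ⟨r, hr, hrn, hrS, hrT, hr4, h8S, h8T, hSres, hTres⟩ :=
    exists_prime_prescribed_residues S T hS hT hST n
  -- the field of discriminant `-r`
  have hD : ((-(r : ℤ)) % 4 = 1 ∧ Squarefree (-(r : ℤ)) ∧ -(r : ℤ) ≠ 1) ∨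
      (4 ∣ -(r : ℤ) ∧ (-(r : ℤ) / 4 % 4 = 2 ∨ -(r : ℤ) / 4 % 4 = 3) ∧ Squarefree (-(r : ℤ) / 4)) := by
    refine Or.inl ⟨by omega, ?_, by omega⟩
    rw [← Int.squarefree_natAbs]
    simpa using hr.squarefree
  obtain ⟨L, _, _, h2, hdisc⟩ := exists_numberField_discr_eq hD
  -- no prime of `S ∪ T` divides `d_L = -r`
  have hndvd : ∀ l : ℕ, l.Prime → l ≠ r → ¬ (l : ℤ) ∣ NumberField.discr L := by
    intro l hl hlr h
    rw [hdisc, Int.dvd_neg, Int.natCast_dvd_natCast] at h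
    exact hlr ((Nat.prime_dvd_prime_iff_eq hl hr).mp h)
  refine ⟨r, L, inferInstance, inferInstance, hr, hrn, hrS, hrT, hr4, h2, hdisc, ?_, ?_,
    fun l hl hlr => isUnramifiedIn_of_discr_eq_neg_prime hr hdisc hl hlr⟩
  · intro p hpS
    have hp := hS p hpS
    have hpr : p ≠ r := fun h => hrS (h ▸ hpS)
    refine ⟨hndvd p hp hpr, ?_⟩
    by_cases hp2 : p = 2
    · subst hp2
      have h2T : 2 ∉ T := Finset.disjoint_left.mp hST hpS
      exact_mod_cast ncard_primesOver_two_eq_two_of_discr_eq_neg h2 hdisc (h8S h2T)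
    · exact ncard_primesOver_eq_two_of_discr_eq_neg h2 hdisc hp hp2 (hSres p hpS hp2)
  · intro q hqT
    have hq := hT q hqT
    have hqr : q ≠ r := fun h => hrT (h ▸ hqT)
    refine ⟨hndvd q hq hqr, ?_⟩
    by_cases hq2 : q = 2
    · subst hq2
      have : NumberField.discr L % 8 = 5 := by rw [hdisc]; have := h8T hqT; omega
      exact_mod_cast ncard_primesOver_two_eq_one_of_discr_mod_eight h2 this
    · haveI : Fact q.Prime := ⟨hq⟩
      refine ncard_primesOver_eq_one_of_legendreSym_eq_neg_one h2 ?_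
      rw [hdisc, legendreSym.eq_neg_one_iff, Int.cast_neg, Int.cast_natCast]
      exact (hTres q hqT hq2).2

/-- **The class-number-free auxiliary field, in the shape consumed by the BSD residual programme**
(the displayed hypothesis CL(p) of `SignedLowerHalvesKobayashiLowerHalfSemistableScopeReduction.lean`
WITHOUT its clause `¬ p ∣ h_L`): for all disjoint finite sets `S`, `T` of primes there is an
imaginary quadratic field (`[L : ℚ] = 2`, `d_L < 0`) with every prime of `S` split, every prime of
`T` inert, all prime to `d_L`. [cite: IrelandRosen1990, Ch. 16 §1 Thm. 1 (Dirichlet's theorem on primes in arithmetic progressions)]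
[cite: Marcus2018, Ch. 3 Thm. 25 (decomposition law in quadratic fields)] -/
theorem exists_imaginaryQuadratic_split_inert' (S T : Finset ℕ) (hS : ∀ p ∈ S, p.Prime)
    (hT : ∀ q ∈ T, q.Prime) (hST : Disjoint S T) :
    ∃ (L : Type) (_ : Field L) (_ : NumberField L),
      finrank ℚ L = 2 ∧ NumberField.discr L < 0 ∧
      (∀ p ∈ S, ¬ (p : ℤ) ∣ NumberField.discr L ∧
        ((span {(p : ℤ)}).primesOver (𝓞 L)).ncard = 2) ∧
      (∀ q ∈ T, ¬ (q : ℤ) ∣ NumberField.discr L ∧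
        ((span {(q : ℤ)}).primesOver (𝓞 L)).ncard = 1) := by
  obtain ⟨r, L, _, _, hr, -, -, -, -, h2, hdisc, hSsp, hTin, -⟩ :=
    exists_imaginaryQuadratic_split_inert S T hS hT hST 0
  exact ⟨L, inferInstance, inferInstance, h2, by rw [hdisc, neg_lt_zero]; exact_mod_cast hr.pos,
    hSsp, hTin⟩

end SplitInert

end Literature.NumberTheory.QuadraticFields.Quadratic

end
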